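import Literature.IUT.HodgeTheaters.PiAvatarEvalSectionsOuterActionsOfBadPairs
import HarnessLib

/-!
# [IUTchI] Example 4.4 (ii), the bracket «[not necessarily unique, but determined up to finite ambiguity — cf. [SemiAnbd], Theorem 6.4!]»: the
# ARITHMETIC part of the ambiguity of the outer isomorphism `π₁^geo(𝒟_{v_j}) ⥲ π₁^geo(𝒟_{>,v})` VANISHES modulo «`Z_{G_F}(G_v̲) = 1`» — the residual
# ambiguity is `N_{Δ_{C_F}}(Π_v̲)`, purely geometric (proof-only sequel to `PiAvatarEvalSectionsOuterActionsOfBadPairs`, abc-iut-L5-t3 lineage)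

S. Mochizuki, *Inter-universal Teichmüller theory I*, kurims manuscript (May 2020), Example 4.4 (ii) p. 107 l. 7–17 («… the induced homomorphism
`π₁(𝒟_{v_j}) → π₁(𝒟_{>,v})` [well-defined, up to composition with an inner automorphism] is compatible with the respective outer actions … on
`π₁^geo(𝒟_{v_j})`, `π₁^geo(𝒟_{>,v})` for some [not necessarily unique, but determined up to finite ambiguity — cf. [SemiAnbd], Theorem 6.4!] outer
isomorphism `π₁^geo(𝒟_{v_j}) ⥲ π₁^geo(𝒟_{>,v})`»), Definition 3.1 (e) p. 62 («the decomposition group `G_v ⊆ G_K`») ([IUTchI] Ex 4.4 (ii) p.107)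
[claim: Mochizuki2012, status: disputed] (D-0012 claim key, series status DISPUTED — kernel theorems of group theory over abc-iut-L5-t2's REAL
`InitialThetaData`, abc-iut-L5-t4's local data / genuine-shape Θ-NF kit `baseKitThetaNFOfBadPairs`, abc-iut-L5-t3's evaluation-section DATA and
`PiAvatarEvalSectionsOuterActionsOfBadPairs` (p495156); nothing of the series is asserted, no side is taken on [IUTchIII] Cor. 3.12).

## What this file adds (abc-iut-L5-t3 gen 9, sequel)

`PiAvatarEvalSectionsOuterActionsOfBadPairs` proved that, for a representative `ψ` of a constituent of `φ^Θ_{v̲_j}` and one admissible `a ∈ N(Π_v̲)`, the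
admissible elements form EXACTLY the coset `A·a`, `A = {b ∈ N_{Π_{C_F}}(Π_v̲) | aug(b) ∈ Z_{G_F}(G_v̲)}` (`LocalDatum.outerIso_admissible_iff`), with
finiteness NOT asserted.  Here the `G`-side is settled modulo ONE displayed binder:

* `EvalSections.map_augGF_eq`: `aug(Π_v̲) = G_v̲` — the augmentation maps `Π_v̲` ONTO the group `Gv` the evaluation sections are defined on (sections
  give `⊇`, the binder's `aug_mem` gives `⊆`);
* `EvalSections.augGF_mem_centralizer_of_commute`, `mem_DeltaC_of_commute_augGF`: an element of `A` has `aug(b) ∈ Z_{G_F}(G_v̲)`, so under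
  `hZ : Z_{G_F}(G_v̲) = 1` (`Subgroup.centralizer (Gv : Set (Fbar ≃ₐ[F] Fbar)) = ⊥`) it lies in `Δ_{C_F} = Ker aug`;
* **`EvalSections.outerIso_admissible_iff_of_centralizer_eq_bot`**: modulo `hZ` the admissible set is EXACTLY `N_{Δ_{C_F}}(Π_v̲)·a` — the ambiguity of
  the outer isomorphism of `π₁^geo` is PURELY GEOMETRIC (conjugation by elements of `Δ_{C_F}` normalising `Π_v̲`), which is where print's pointer to the
  `π₁^geo`-statement [SemiAnbd] Thm 6.4 lives; `outerAction_compatible_geometricAmbiguity_of_mem_thetaClass` packages (α) + this + (β);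
* `gv_eq_galoisSubgroupOf_inf_decompAt`: at a bad index of the parametric bad-pair Θ-kit the group of the evaluation-section binder IS `G_K ∩ G_v̲`
  (`BadPairAt.map_augGF` LAW, Def 3.1 (e)), and `outerAction_compatible_geometricAmbiguity_thetaOfBadPairs` is the kit form with DISPLAYED binders
  {`CG`, `hS`, `M`, `hA`, `hI`} ∪ {`B`, `ΛBad`} ∪ {`ES`} ∪ {`hZ` at `G_K ∩ G_v̲`}.

HONEST LABEL of `hZ`: «`Z_{G_F}(G_K ∩ G_v̲) = 1`» is the INSTANCE of [AbsAnab] Theorem 1.1.1 (ii), first clause — relative slimness of `G_𝔭 ↪ G_F`: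
the centraliser in `G_F` of every OPEN subgroup of a decomposition group is trivial — at the open subgroup `G_K ∩ G_v̲` of the `F`-decomposition group
containing `G_v̲`; that fact is FACT-LIST F-0029 `Literature.AnabelianGeometry.AbsoluteAnabelian.galoisNF_decomposition_relativelySlim`, PROVED in the
tree (`galoisNF_decomposition_relativelySlim_holds`, abc-iut-w5-d231) over `AlgebraicClosure F` / `decompositionGroupNF`.  The junction «abc-iut-L5-t4's
`D.decompAt v̲` (image of `Gal(K̄_w/K_w) → G_F` along a chosen embedding, `PiAvatarPlaceData`) transported along `Fbar ≃ₐ[F] AlgebraicClosure F` is an open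
subgroup of some `decompositionGroupNF F A`» is NOT discharged here — `hZ` stays DISPLAYED (binder ≠ fact).  Finiteness of the geometric residue
`N_{Δ_{C_F}}(Π_v̲)/Δ_v̲` (print: [SemiAnbd] Thm 6.4) is NOT asserted.  Proof-only: no `def`, no instance, no notation, no `Prop` fact; typed ≠ inhabited
≠ proved elsewhere.
-/

namespace Literature.IUT.HodgeTheaters

open CategoryTheory

universe u v w

section EvalSectionsOuterIsoGeometricAmbiguity

variable {F : Type u} {K : Type v} {Fbar : Type w} [Field F] [NumberField F] [Field K] [NumberField K]
  [Algebra F K] [Field Fbar] [Algebra F Fbar] [Algebra K Fbar]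
  {E : WeierstrassCurve F} [E.IsElliptic] {l : ℕ} {Pb : BadPlacePredicates K}
  {D : InitialThetaData F K Fbar E l Pb} {CG : D.geom.pe.CuspGalois} {hS : D.CuspClassesNormaliserStable} [Fact l.Prime]

namespace InitialThetaData

namespace EvalSections

variable {δ : D.LocalDatum CG hS} {Gv : Subgroup (Fbar ≃ₐ[F] Fbar)} (ES : EvalSections δ Gv)

/-! ### §1. `aug(Π_v̲) = G_v̲` and the `G`-side of the ambiguity group -/

include ES in
/-- **`aug(Π_v̲) = G_v̲`**: the augmentation `Π_{C_F} ↠ G_F` maps `Π_v̲` ONTO the group `G_v̲` on which the evaluation sections are defined — `⊆` is the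
binder's `aug_mem` («via composition with the natural surjection `Π_v ↠ G_v`»), `⊇` because `s_j` is a section with values in `Π_v̲`.
([IUTchI] Ex 4.4 (i) p.106) [claim: Mochizuki2012, status: disputed] -/
theorem map_augGF_eq : δ.H.map D.augGF = Gv := by
  ext z
  constructor
  · rintro ⟨x, hx, rfl⟩
    exact ES.aug_mem x hx
  · intro hz
    exact ⟨ES.sect (FlAbs.zero l) ⟨z, hz⟩, ES.sect_mem _ _, ES.aug_sect _ _⟩

include ES in
/-- If `aug(b)` commutes with `aug(g)` for every `g ∈ Π_v̲`, then `aug(b)` CENTRALISES `G_v̲` (every element of `G_v̲` is `aug` of a value of a section).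
([IUTchI] Ex 4.4 (ii) p.107) [claim: Mochizuki2012, status: disputed] -/
theorem augGF_mem_centralizer_of_commute {b : D.PiC} (hc : ∀ g : ↥δ.H, Commute (D.augGF b) (D.augGF (g : D.PiC))) :
    D.augGF b ∈ Subgroup.centralizer (Gv : Set (Fbar ≃ₐ[F] Fbar)) := by
  rw [Subgroup.mem_centralizer_iff]
  intro z hz
  have h := hc ⟨ES.sect (FlAbs.zero l) ⟨z, hz⟩, ES.sect_mem _ _⟩
  change Commute (D.augGF b) (D.augGF (ES.sect (FlAbs.zero l) ⟨z, hz⟩)) at h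
  rw [ES.aug_sect] at h
  exact h.eq.symm

include ES in
/-- **Modulo `hZ : Z_{G_F}(G_v̲) = 1` the ambiguity group lies in `Δ_{C_F}`**: if `aug(b)` commutes with `aug(Π_v̲)` then `b ∈ Δ_{C_F} = Ker aug`.  (`hZ` is
the instance of [AbsAnab] Thm 1.1.1 (ii) — relative slimness, F-0029, PROVED in the tree as `galoisNF_decomposition_relativelySlim_holds` — at the
open subgroup `G_v̲` of its `F`-decomposition group; DISPLAYED here, not discharged.) ([IUTchI] Ex 4.4 (ii) p.107) [claim: Mochizuki2012, status: disputed] -/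
theorem mem_DeltaC_of_commute_augGF (hZ : Subgroup.centralizer (Gv : Set (Fbar ≃ₐ[F] Fbar)) = ⊥) {b : D.PiC}
    (hc : ∀ g : ↥δ.H, Commute (D.augGF b) (D.augGF (g : D.PiC))) : b ∈ D.DeltaC := by
  rw [← D.augGF_eq_one_iff, ← Subgroup.mem_bot, ← hZ]
  exact ES.augGF_mem_centralizer_of_commute hc

/-! ### §2. The ambiguity of the outer isomorphism is purely geometric modulo `Z_{G_F}(G_v̲) = 1` -/

include ES in
/-- **THE GEOMETRIC AMBIGUITY** (Example 4.4 (ii)'s bracket, `G`-side settled): modulo `hZ : Z_{G_F}(G_v̲) = 1`, for a representative `ψ` and one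
admissible `a ∈ N(Π_v̲)`, an element `a′ ∈ Π_{C_F}` is admissible for `ψ` — `a′ ∈ N(Π_v̲)` and `ψ(g) = a′⁻¹ga′·d′_g`, `d′_g ∈ Δ_v̲` — IF AND ONLY IF
`a′a⁻¹ ∈ N_{Δ_{C_F}}(Π_v̲) = N_{Π_{C_F}}(Π_v̲) ∩ Δ_{C_F}`: the outer isomorphisms `x ↦ a′⁻¹xa′` of `π₁^geo = Δ_v̲` through which `ψ` is compatible with
the outer actions form ONE orbit under conjugation by geometric elements normalising `Π_v̲` (finiteness of `N_{Δ_{C_F}}(Π_v̲)/Δ_v̲`: print's [SemiAnbd]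
Thm 6.4, NOT asserted). ([IUTchI] Ex 4.4 (ii) p.107) [claim: Mochizuki2012, status: disputed] -/
theorem outerIso_admissible_iff_of_centralizer_eq_bot (hZ : Subgroup.centralizer (Gv : Set (Fbar ≃ₐ[F] Fbar)) = ⊥)
    (ψ : ↥δ.H →* ↥δ.H) {a : D.PiC} (ha : a ∈ Subgroup.normalizer ((δ.H : Subgroup D.PiC) : Set D.PiC))
    (h : ∀ g : ↥δ.H, ∃ d : ↥δ.H, (d : D.PiC) ∈ D.DeltaC ∧ (ψ g : D.PiC) = a⁻¹ * g * a * d) (a' : D.PiC) :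
    (a' ∈ Subgroup.normalizer ((δ.H : Subgroup D.PiC) : Set D.PiC) ∧
        ∀ g : ↥δ.H, ∃ d : ↥δ.H, (d : D.PiC) ∈ D.DeltaC ∧ (ψ g : D.PiC) = a'⁻¹ * g * a' * d) ↔
      (a' * a⁻¹ ∈ Subgroup.normalizer ((δ.H : Subgroup D.PiC) : Set D.PiC) ∧ a' * a⁻¹ ∈ D.DeltaC) := by
  rw [δ.outerIso_admissible_iff ψ ha h a']
  refine ⟨fun hb => ⟨hb.1, ES.mem_DeltaC_of_commute_augGF hZ hb.2⟩, fun hb => ⟨hb.1, fun g => ?_⟩⟩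
  rw [(D.augGF_eq_one_iff _).mpr hb.2]
  exact Commute.one_left _

/-- **Example 4.4 (ii) + Example 4.5 (i) (bad place) WITH THE GEOMETRIC AMBIGUITY, over the evaluation-section DATA, modulo `hZ : Z_{G_F}(G_v̲) = 1`**: for
every constituent `f ∈ thetaClass j` of `φ^Θ_{v̲_j}` and every representative `ψ`: (α) an admissible `a ∈ N(Π_v̲)` exists (the outer isomorphism
`x ↦ a⁻¹xa` of `π₁^geo` NAMED, p490176); the admissible elements are EXACTLY `N_{Δ_{C_F}}(Π_v̲)·a` («determined up to [this, geometric] ambiguity»); `ψ`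
kills `π₁^geo`; and (β) every element of `N(Π_v̲)` has slope class `1`, so the `LabCusp` bijection of Example 4.5 (i) at `v ∈ 𝕍^bad` is the identity on
Prop 4.2's canonical labels whichever admissible outer isomorphism is used. ([IUTchI] Ex 4.4 (ii) p.107) [claim: Mochizuki2012, status: disputed] -/
theorem outerAction_compatible_geometricAmbiguity_of_mem_thetaClass (hZ : Subgroup.centralizer (Gv : Set (Fbar ≃ₐ[F] Fbar)) = ⊥)
    {j : FlAbs l} {f : OuterHom δ.H δ.H} (hf : f ∈ ES.thetaClass j) (ψ : ↥δ.H →* ↥δ.H) (hψ : OuterHom.ofHom ψ = f) :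
    ∃ (a : D.PiC) (ha : a ∈ Subgroup.normalizer ((δ.H : Subgroup D.PiC) : Set D.PiC)),
      (∀ g : ↥δ.H, ∃ d : ↥δ.H, (d : D.PiC) ∈ D.DeltaC ∧ (ψ g : D.PiC) = a⁻¹ * g * a * d) ∧
      (∀ a' : D.PiC,
        (a' ∈ Subgroup.normalizer ((δ.H : Subgroup D.PiC) : Set D.PiC) ∧
            ∀ g : ↥δ.H, ∃ d : ↥δ.H, (d : D.PiC) ∈ D.DeltaC ∧ (ψ g : D.PiC) = a'⁻¹ * g * a' * d) ↔
          (a' * a⁻¹ ∈ Subgroup.normalizer ((δ.H : Subgroup D.PiC) : Set D.PiC) ∧ a' * a⁻¹ ∈ D.DeltaC)) ∧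
      (∀ x : ↥δ.H, (x : D.PiC) ∈ D.DeltaC → ψ x = 1) ∧
      D.slopeStar CG hS ⟨a, δ.law.normalizer_le ha⟩ = 1 ∧
      ∀ (a' : D.PiC) (ha' : a' ∈ Subgroup.normalizer ((δ.H : Subgroup D.PiC) : Set D.PiC)),
        D.slopeStar CG hS ⟨a', δ.law.normalizer_le ha'⟩ = 1 := by
  obtain ⟨a, ha, h⟩ := ES.outerAction_compatible_of_mem_thetaClass hf ψ hψ
  exact ⟨a, ha, h, ES.outerIso_admissible_iff_of_centralizer_eq_bot hZ ψ ha h,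
    fun x hx => ES.rep_eq_one_of_mem_DeltaC_of_mem_thetaClass hf ψ hψ hx,
    slopeStar_eq_one_of_mem_normalizer ha, fun a' ha' => slopeStar_eq_one_of_mem_normalizer ha'⟩

end EvalSections

/-! ### §3. AT THE PARAMETRIC BAD-PAIR Θ-KIT: the group of the evaluation-section binder is `G_K ∩ G_v̲`, and the kit form of §2 -/

variable (D CG hS)
variable (M : D.TorsionMonodromy) (hA : D.geom.pe.ArrowCoveringClaims)
  (hI : ∀ k ∈ D.geom.pe.inertia D.geom.pe.ε1, M.tau (D.geom.embK k) = 0)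
  (B : ∀ v, v ∈ D.indexCopyBad → D.BadPairAt v) (ΛBad : ∀ v (h : v ∈ D.indexCopyBad), D.LocalArrowLaw CG hS (B v h).H)
  {Gv : D.IndexCopy → Subgroup (Fbar ≃ₐ[F] Fbar)}
  (ES : ∀ v, v ∈ D.indexCopyBad → EvalSectionBinder (D.localDataOfBadPairs CG hS M hA hI B ΛBad v) (Gv v))

include ES in
/-- **At a bad index the group of the evaluation-section binder IS `G_K ∩ G_v̲`** (Def 3.1 (e) «the decomposition group `G_v ⊆ G_K`»): `Π_v̲ = Π_{X̲̳_v̲}`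
there (`localDatumAt_H`, `localGroupAt_of_mem`) surjects onto `G_K ∩ G_v̲` by the bad-pair LAW `BadPairAt.map_augGF`, and onto `Gv v̲` by
`EvalSections.map_augGF_eq` — so the binder `hZ` of the next theorem reads «`Z_{G_F}(G_K ∩ G_v̲) = 1`», the instance of [AbsAnab] Thm 1.1.1 (ii)
(relative slimness, F-0029) at the open subgroup `G_K ∩ G_v̲` of the `F`-decomposition group. ([IUTchI] Def 3.1 (e) p.62) [claim: Mochizuki2012, status: disputed] -/
theorem gv_eq_galoisSubgroupOf_inf_decompAt {v : D.IndexCopy} (hv : v ∈ D.indexCopyBad) :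
    Gv v = galoisSubgroupOf F K Fbar ⊓ D.decompAt v := by
  rw [← (ES v hv).toEvalSections.map_augGF_eq]
  change (D.localDatumAt B CG hS hA _ v).H.map D.augGF = _
  rw [D.localDatumAt_H, D.localGroupAt_of_mem B hv, (B v hv).map_augGF]

/-- **Examples 4.4 (ii) / 4.5 (i) (bad place) WITH THE GEOMETRIC AMBIGUITY, AT THE PARAMETRIC BAD-PAIR Θ-KIT** — DISPLAYED binders {`CG`, `hS`, `M`, `hA`,
`hI`} ∪ {`B`, `ΛBad`} ∪ {`ES`} ∪ {`hZ` : `Z_{G_F}(Gv v̲) = 1`, i.e. `Z_{G_F}(G_K ∩ G_v̲) = 1` by `gv_eq_galoisSubgroupOf_inf_decompAt` — [AbsAnab] Thm 1.1.1 (ii)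
instance, not discharged}: for every constituent `g` of `(D.multKitThetaNFOfBadPairs CG hS M hA hI B ΛBad ES).thetaPolyBad j v hv` and every representative
`ψ` of `g.out`, an admissible `a ∈ N(Π_v̲)` exists, the admissible elements are EXACTLY `N_{Δ_{C_F}}(Π_v̲)·a` (the ambiguity of the outer isomorphism of
`π₁^geo` is purely geometric), `ψ` kills `π₁^geo`, and every element of `N(Π_v̲)` has slope class `1` (Ex 4.5 (i)'s `LabCusp` bijection is well defined).
([IUTchI] Ex 4.4 (ii) p.107) [claim: Mochizuki2012, status: disputed] -/
theorem outerAction_compatible_geometricAmbiguity_thetaOfBadPairs {v : D.IndexCopy} (hv : v ∈ D.indexCopyBad)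
    (hZ : Subgroup.centralizer ((Gv v : Subgroup (Fbar ≃ₐ[F] Fbar)) : Set (Fbar ≃ₐ[F] Fbar)) = ⊥) (j : Fin (lStar l))
    {g : (D.baseKitThetaNFOfBadPairs CG hS M hA hI B ΛBad).model v ⟶ (D.baseKitThetaNFOfBadPairs CG hS M hA hI B ΛBad).model v}
    (hg : g ∈ (D.multKitThetaNFOfBadPairs CG hS M hA hI B ΛBad ES).thetaPolyBad j v hv)
    (ψ : ↥(D.localDataOfBadPairs CG hS M hA hI B ΛBad v).H →* ↥(D.localDataOfBadPairs CG hS M hA hI B ΛBad v).H)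
    (hψ : OuterHom.ofHom ψ = g.out) :
    ∃ (a : D.PiC) (ha : a ∈ Subgroup.normalizer (((D.localDataOfBadPairs CG hS M hA hI B ΛBad v).H : Subgroup D.PiC) : Set D.PiC)),
      (∀ g' : ↥(D.localDataOfBadPairs CG hS M hA hI B ΛBad v).H, ∃ d : ↥(D.localDataOfBadPairs CG hS M hA hI B ΛBad v).H,
        (d : D.PiC) ∈ D.DeltaC ∧ (ψ g' : D.PiC) = a⁻¹ * g' * a * d) ∧
      (∀ a' : D.PiC,
        (a' ∈ Subgroup.normalizer (((D.localDataOfBadPairs CG hS M hA hI B ΛBad v).H : Subgroup D.PiC) : Set D.PiC) ∧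
            ∀ g' : ↥(D.localDataOfBadPairs CG hS M hA hI B ΛBad v).H, ∃ d : ↥(D.localDataOfBadPairs CG hS M hA hI B ΛBad v).H,
              (d : D.PiC) ∈ D.DeltaC ∧ (ψ g' : D.PiC) = a'⁻¹ * g' * a' * d) ↔
          (a' * a⁻¹ ∈ Subgroup.normalizer (((D.localDataOfBadPairs CG hS M hA hI B ΛBad v).H : Subgroup D.PiC) : Set D.PiC) ∧
            a' * a⁻¹ ∈ D.DeltaC)) ∧
      (∀ x : ↥(D.localDataOfBadPairs CG hS M hA hI B ΛBad v).H, (x : D.PiC) ∈ D.DeltaC → ψ x = 1) ∧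
      D.slopeStar CG hS ⟨a, (D.localDataOfBadPairs CG hS M hA hI B ΛBad v).law.normalizer_le ha⟩ = 1 ∧
      ∀ (a' : D.PiC) (ha' : a' ∈ Subgroup.normalizer (((D.localDataOfBadPairs CG hS M hA hI B ΛBad v).H : Subgroup D.PiC) : Set D.PiC)),
        D.slopeStar CG hS ⟨a', (D.localDataOfBadPairs CG hS M hA hI B ΛBad v).law.normalizer_le ha'⟩ = 1 := by
  change g.deg = true ∧ g.out ∈ (ES v hv).thetaClass (FlStar.toFlAbs l (FlStar.ofFin l j)) at hg
  exact (ES v hv).toEvalSections.outerAction_compatible_geometricAmbiguity_of_mem_thetaClass hZ hg.2 ψ hψ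

end InitialThetaData

end EvalSectionsOuterIsoGeometricAmbiguity

end Literature.IUT.HodgeTheaters
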